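import Literature.Topology.FourManifolds.SurgeryTubeCylinderFrame
import Literature.Topology.FourManifolds.FramedSphereFamilyTwist
import HarnessLib

/-!
# Cylinder frames of a spherical modification, III: the tube transition matrix and its twisting

Topic `Literature/Topology/FourManifolds` (fact seat of
`Literature.Topology.FourManifolds.HomotopySphere.boundsContractible_of_nullCobordism_isStablyParallelizable_four`;
towards Kervaire–Milnor's Lemma 5.4 / 6.2).  For a stable frame datum `S` of the manifold `X`
(`SFrame`) and a framed sphere `φᵢ` of `ν`, the **tube transition matrix**
`ν.tubeTrans i h S q = compMat (S at φᵢ q) (tubeCyl q)` expresses the framing of `X` in the tube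
cylinder frame; it is continuous on the whole tube `Sᵏ × ℝˡ⁺¹`, cores included
(`continuous_tubeTrans`), with non-zero determinant.  Its restriction `β(u) = tubeTrans (u, 0)` to
the core is Kervaire–Milnor's comparison map `Sᵏ → GL` of §6 (p. 521: "`γ(φ)` is the homotopy
class of the map `g : Sᵖ → SO_{n+1}`, where `g(u)` is the matrix `⟨fⁿ⁺¹, i'_*(tⁿ⁺¹)⟩` at
`φ(u, 0)`"), and re-framing the sphere by `α` multiplies it by the block matrix of `1 ⊕ α(u)`
(Lemma 6.1, p. 521: "`i'_α(tⁿ⁺¹) = i'(tⁿ⁺¹) · s(α)`"):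

* `FramedSphereFamily.tubeTrans`, `continuous_tubeTrans`, `det_tubeTrans_ne_zero`;
* `FramedSphereFamily.twistLin T u` — the linear map `(x₁, x₂) ↦ (x₁, a(u) x₂)` of
  `ℝᵏ⁺¹ × ℝˡ⁺¹` — and **`coneDeriv_twist_zero`**: on the core, the differential of the cone of the
  re-framed sphere `ν.twist T` is `dφ̂ ∘ twistLin` (chain rule through the fibrewise linear
  diffeomorphism, whose differential at `(u, 0)` is `(ξ, ẇ) ↦ (ξ, a(u) ẇ)`);
* `StableFrames.SurgerySwap.cylT_comp` — `cylT p h (L ∘ M) = (cylT p h L) · [M]` for `M`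
  commuting with the tube projection and preserving the normal coefficient; hence
  **`tubeCyl_twist_zero`** and **`tubeTrans_twist_zero`**:
  `tubeTrans' (u, 0) = [1 ⊕ a(u)]⁻¹ · tubeTrans (u, 0)`.

Everything is proved; the `def`s are explicit; no named facts.

## References

* M. Kervaire, J. Milnor, *Groups of homotopy spheres I*, Ann. of Math. (2) 77 (1963), §6,
  pp. 520–521, Lemma 6.1. doi:10.2307/1970128 [KervaireMilnorAnnals1963]
* A. Kosinski, *Differential Manifolds* (1993), Ch. X §2, Lemma (2.1), p. 200. [Kosinski1993]
-/

noncomputable section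

open scoped Manifold ContDiff Topology RealInnerProductSpace
open Set Function Bundle Metric Module

namespace Literature.Topology.FourManifolds

open StableFrames StableFrames.SurgerySwap

/-! ### `cylT` for a composite differential -/

namespace StableFrames.SurgerySwap

attribute [local instance] fact_finrank_euclideanSpace_succ

variable {k m N' : ℕ}

/-- **The tube cylinder frame of a composite `L ∘ M`** is the frame of `L` acted on by the matrix
of `M`, provided `M` commutes with the tube projection `PT` and preserves the normal coefficient
`aF` (Kervaire–Milnor 1963, proof of Lemma 6.1: "`i'_α(tⁿ⁺¹) = i'(tⁿ⁺¹) · s(α)`").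
[cite: KervaireMilnorAnnals1963, Lemma 6.1 (p. 521)] -/
theorem cylT_comp (p : EuclideanSpace ℝ (Fin (k + 1)) × EuclideanSpace ℝ (Fin m))
    (h : k + 1 + m = N' + 1)
    (L : (EuclideanSpace ℝ (Fin (k + 1)) × EuclideanSpace ℝ (Fin m)) →ₗ[ℝ] EuclideanSpace ℝ (Fin N'))
    (M : (EuclideanSpace ℝ (Fin (k + 1)) × EuclideanSpace ℝ (Fin m)) →ₗ[ℝ]
      (EuclideanSpace ℝ (Fin (k + 1)) × EuclideanSpace ℝ (Fin m)))
    (hPT : ∀ x, PT p (M x) = M (PT p x)) (haF : ∀ x, aF p (M x) = aF p x) :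
    cylT p h (L.comp M) = act (cylT p h L) (LinearMap.toMatrix (jbasis h) (jbasis h) M) := by
  funext j
  have hsum : ∑ i, LinearMap.toMatrix (jbasis h) (jbasis h) M i j • jbasis h i = M (jbasis h j) := by
    simp_rw [LinearMap.toMatrix_apply]
    exact (jbasis h).sum_repr _
  simp only [act, cylT]
  refine Prod.ext ?_ ?_
  · rw [Prod.fst_sum]
    simp only [Prod.smul_fst, LinearMap.comp_apply]
    rw [← hPT, ← hsum, map_sum, map_sum]
    refine Finset.sum_congr rfl fun i _ => ?_
    rw [map_smul, map_smul]
  · rw [Prod.snd_sum]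
    simp only [Prod.smul_snd]
    rw [← haF (jbasis h j), ← hsum, map_sum]
    refine Finset.sum_congr rfl fun i _ => ?_
    rw [map_smul, smul_eq_mul]

end StableFrames.SurgerySwap

/-! ### Comparison of a frame field with a frame field acted on by matrices -/

namespace StableFrames

/-- `compMat A (B · C) = C⁻¹ · compMat A B` for an invertible `C` (uniqueness of coordinates).
[folklore] -/
theorem compMat_act_right {d : ℕ} {A B : Fr d} (hB : LinearIndependent ℝ B)
    {C : Matrix (Fin (d + 1)) (Fin (d + 1)) ℝ} (hC : C.det ≠ 0) :
    compMat A (act B C) = C⁻¹ * compMat A B := by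
  have hBC : LinearIndependent ℝ (act B C) := linearIndependent_act hB hC
  have h1 : A = act (act B C) (C⁻¹ * compMat A B) := by
    rw [← act_mul, ← Matrix.mul_assoc, Matrix.mul_nonsing_inv _ (Ne.isUnit hC), Matrix.one_mul,
      act_compMat hB]
  conv_lhs => rw [h1]
  exact compMat_act_self hBC _

end StableFrames

/-! ### The tube transition matrix -/

namespace FramedSphereFamily

universe u

attribute [local instance] fact_finrank_euclideanSpace_succ

section Trans

variable {n k l : ℕ} {X : Type u} [TopologicalSpace X] [ChartedSpace (EuclideanHalfSpace (n + 1)) X]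
  [IsManifold (𝓡∂ (n + 1)) ∞ X] {ι : Type u}
  (ν : FramedSphereFamily (𝓡∂ (n + 1)) X ι k (l + 1)) (i : ι) (h : k + 1 + (l + 1) = n + 1 + 1)
  (S : SFrame n X)

/-- The stable frame datum `S` read at the point `x`, as a family. [folklore] -/
def frameAt (x : X) : Fr (n + 1) := fun j => S.s j x

/-- **The tube transition matrix**: the framing `S` of `X` expressed in the tube cylinder frame at
`φᵢ q`, `compMat (S at φᵢ q) (tubeCyl q)` (Kervaire–Milnor 1963, §6 p. 521: the matrix
`⟨fⁿ⁺¹, i'_*(tⁿ⁺¹)⟩`). [cite: KervaireMilnorAnnals1963, §6 p. 521] -/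
def tubeTrans (q : Metric.sphere (0 : EuclideanSpace ℝ (Fin (k + 1))) 1 × EuclideanSpace ℝ (Fin (l + 1))) :
    Matrix (Fin (n + 1 + 1)) (Fin (n + 1 + 1)) ℝ :=
  compMat (frameAt S (ν.toFun i q)) (ν.tubeCyl i h q)

/-- **The tube transition matrix is continuous on the whole tube** (cores included): it compares
two stable frame fields along `φᵢ`. [cite: KervaireMilnorAnnals1963, §6 p. 521] -/
theorem continuous_tubeTrans : Continuous (ν.tubeTrans i h S) := by
  have h1 : IsFrameFieldAlong (𝓡∂ (n + 1)) (fun q => ν.toFun i q) (fun q => frameAt S (ν.toFun i q)) univ :=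
    S.isFrameFieldAlong (ν.continuous i).continuousOn
  have h2 := ν.isFrameFieldAlong_tubeCyl i h
  exact continuousOn_univ.1 (h1.continuousOn_compMat h2)

/-- The tube transition matrix is invertible. [folklore] -/
theorem det_tubeTrans_ne_zero
    (q : Metric.sphere (0 : EuclideanSpace ℝ (Fin (k + 1))) 1 × EuclideanSpace ℝ (Fin (l + 1))) :
    (ν.tubeTrans i h S q).det ≠ 0 :=
  det_compMat_ne_zero (S.linearIndependent _) (ν.linearIndependent_tubeCyl i h q)

/-- The framing `S` is the tube cylinder frame acted on by the transition matrix. [folklore] -/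
theorem act_tubeCyl_tubeTrans
    (q : Metric.sphere (0 : EuclideanSpace ℝ (Fin (k + 1))) 1 × EuclideanSpace ℝ (Fin (l + 1))) :
    act (ν.tubeCyl i h q) (ν.tubeTrans i h S q) = frameAt S (ν.toFun i q) :=
  act_compMat (ν.linearIndependent_tubeCyl i h q)

end Trans

/-! ### Twisting: the differential of the cone of the re-framed sphere on the core -/

section Twist

variable {EX HX : Type*} [NormedAddCommGroup EX] [NormedSpace ℝ EX] [TopologicalSpace HX]
  {IX : ModelWithCorners ℝ EX HX} {X : Type u} [TopologicalSpace X] [ChartedSpace HX X]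
  [IsManifold IX ∞ X] {ι : Type u} {k m : ℕ}
  (ν : FramedSphereFamily IX X ι k m) (i : ι) (T : TwistData k m)

/-- The linear map `(x₁, x₂) ↦ (x₁, a(u) x₂)` of `ℝᵏ⁺¹ × ℝᵐ`: the differential on the core of
the cone coordinates of the re-framing. [cite: KervaireMilnorAnnals1963, §6 p. 520] -/
def twistLin (u : Metric.sphere (0 : EuclideanSpace ℝ (Fin (k + 1))) 1) :
    (EuclideanSpace ℝ (Fin (k + 1)) × EuclideanSpace ℝ (Fin m)) →L[ℝ]
      (EuclideanSpace ℝ (Fin (k + 1)) × EuclideanSpace ℝ (Fin m)) :=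
  (ContinuousLinearMap.fst ℝ _ _).prod ((T.a u).comp (ContinuousLinearMap.snd ℝ _ _))

/-- Values of `twistLin`. [folklore] -/
@[simp] theorem twistLin_apply (u : Metric.sphere (0 : EuclideanSpace ℝ (Fin (k + 1))) 1)
    (x : EuclideanSpace ℝ (Fin (k + 1)) × EuclideanSpace ℝ (Fin m)) :
    twistLin T u x = (x.1, T.a u x.2) := rfl

/-- **The differential of the re-framing diffeomorphism on the core**:
`d[(u, w) ↦ (u, a(u) w)]_{(u, 0)} = (ξ, ẇ) ↦ (ξ, a(u) ẇ)` (the term `(da(ξ)) w` vanishes at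
`w = 0`). [folklore] -/
theorem mfderiv_diffeo_zero (u : Metric.sphere (0 : EuclideanSpace ℝ (Fin (k + 1))) 1) :
    mfderiv ((𝓡 k).prod 𝓘(ℝ, EuclideanSpace ℝ (Fin m))) ((𝓡 k).prod 𝓘(ℝ, EuclideanSpace ℝ (Fin m)))
        T.diffeo (u, 0) =
      (ContinuousLinearMap.fst ℝ (EuclideanSpace ℝ (Fin k)) (EuclideanSpace ℝ (Fin m))).prod
        ((T.a u).comp (ContinuousLinearMap.snd ℝ (EuclideanSpace ℝ (Fin k)) (EuclideanSpace ℝ (Fin m)))) := by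
  -- the two components of the diffeomorphism
  have hfst : HasMFDerivAt ((𝓡 k).prod 𝓘(ℝ, EuclideanSpace ℝ (Fin m))) (𝓡 k)
      (fun q : Metric.sphere (0 : EuclideanSpace ℝ (Fin (k + 1))) 1 × EuclideanSpace ℝ (Fin m) => q.1)
      (u, (0 : EuclideanSpace ℝ (Fin m)))
      (ContinuousLinearMap.fst ℝ (EuclideanSpace ℝ (Fin k)) (EuclideanSpace ℝ (Fin m))) :=
    hasMFDerivAt_fst (I := 𝓡 k) (I' := 𝓘(ℝ, EuclideanSpace ℝ (Fin m))) _
  set g : Metric.sphere (0 : EuclideanSpace ℝ (Fin (k + 1))) 1 × EuclideanSpace ℝ (Fin m) →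
      EuclideanSpace ℝ (Fin m) := fun q => T.a q.1 q.2 with hg
  have hgd : MDifferentiableAt ((𝓡 k).prod 𝓘(ℝ, EuclideanSpace ℝ (Fin m))) 𝓘(ℝ, EuclideanSpace ℝ (Fin m))
      g (u, 0) :=
    (((T.contMDiff_a.comp contMDiff_fst).clm_apply contMDiff_snd) (u, 0)).mdifferentiableAt (by simp)
  -- `dg_{(u,0)} = a(u) ∘ snd`: the partial derivative in `u` vanishes at `w = 0`
  have hg1 : mfderiv ((𝓡 k).prod 𝓘(ℝ, EuclideanSpace ℝ (Fin m))) 𝓘(ℝ, EuclideanSpace ℝ (Fin m))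
      (fun z : Metric.sphere (0 : EuclideanSpace ℝ (Fin (k + 1))) 1 × EuclideanSpace ℝ (Fin m) =>
        g (z.1, ((u, (0 : EuclideanSpace ℝ (Fin m))) : Metric.sphere (0 : EuclideanSpace ℝ (Fin (k + 1))) 1 ×
          EuclideanSpace ℝ (Fin m)).2)) (u, 0) = 0 := by
    have : (fun z : Metric.sphere (0 : EuclideanSpace ℝ (Fin (k + 1))) 1 × EuclideanSpace ℝ (Fin m) =>
        g (z.1, ((u, (0 : EuclideanSpace ℝ (Fin m))) : Metric.sphere (0 : EuclideanSpace ℝ (Fin (k + 1))) 1 ×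
          EuclideanSpace ℝ (Fin m)).2)) = fun _ => 0 := by
      funext z; simp [hg]
    rw [this, mfderiv_const]
    rfl
  have hg2 : HasMFDerivAt ((𝓡 k).prod 𝓘(ℝ, EuclideanSpace ℝ (Fin m))) 𝓘(ℝ, EuclideanSpace ℝ (Fin m))
      (fun z : Metric.sphere (0 : EuclideanSpace ℝ (Fin (k + 1))) 1 × EuclideanSpace ℝ (Fin m) =>
        g (((u, (0 : EuclideanSpace ℝ (Fin m))) : Metric.sphere (0 : EuclideanSpace ℝ (Fin (k + 1))) 1 ×
          EuclideanSpace ℝ (Fin m)).1, z.2)) (u, 0)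
      ((T.a u).comp (ContinuousLinearMap.snd ℝ (EuclideanSpace ℝ (Fin k)) (EuclideanSpace ℝ (Fin m)))) := by
    have hA : HasMFDerivAt 𝓘(ℝ, EuclideanSpace ℝ (Fin m)) 𝓘(ℝ, EuclideanSpace ℝ (Fin m)) (T.a u)
        ((0 : EuclideanSpace ℝ (Fin m))) (T.a u) :=
      hasMFDerivAt_iff_hasFDerivAt.2 (T.a u).hasFDerivAt
    have hsnd := hasMFDerivAt_snd (I := 𝓡 k) (I' := 𝓘(ℝ, EuclideanSpace ℝ (Fin m)))
      (u, (0 : EuclideanSpace ℝ (Fin m)))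
    exact hA.comp (u, (0 : EuclideanSpace ℝ (Fin m))) hsnd
  have hgsum := mfderiv_prod_eq_add (f := g) hgd
  rw [hg1, hg2.mfderiv, zero_add] at hgsum
  -- assemble
  have hdiff : (T.diffeo : Metric.sphere (0 : EuclideanSpace ℝ (Fin (k + 1))) 1 × EuclideanSpace ℝ (Fin m) → _) =
      fun q => (q.1, g q) := rfl
  rw [hdiff, (hfst.prodMk hgd.hasMFDerivAt).mfderiv, hgsum]
  rfl

/-- Pointwise form of `mfderiv_diffeo_zero`. [folklore] -/
theorem mfderiv_diffeo_zero_apply (u : Metric.sphere (0 : EuclideanSpace ℝ (Fin (k + 1))) 1)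
    (ξ : EuclideanSpace ℝ (Fin k)) (x₂ : EuclideanSpace ℝ (Fin m)) :
    mfderiv ((𝓡 k).prod 𝓘(ℝ, EuclideanSpace ℝ (Fin m))) ((𝓡 k).prod 𝓘(ℝ, EuclideanSpace ℝ (Fin m)))
        T.diffeo (u, 0) (ξ, x₂) = (ξ, T.a u x₂) := by
  rw [mfderiv_diffeo_zero]
  rfl

/-- The twisting linear map has non-zero determinant (inverse `(x₁, x₂) ↦ (x₁, b(u) x₂)`).
[folklore] -/
theorem isUnit_det_twistLin (u : Metric.sphere (0 : EuclideanSpace ℝ (Fin (k + 1))) 1) :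
    IsUnit (LinearMap.det (twistLin T u).toLinearMap) := by
  set f := (twistLin T u).toLinearMap with hf
  set g := (((ContinuousLinearMap.fst ℝ _ _).prod ((T.b u).comp (ContinuousLinearMap.snd ℝ _ _)) :
    (EuclideanSpace ℝ (Fin (k + 1)) × EuclideanSpace ℝ (Fin m)) →L[ℝ]
      (EuclideanSpace ℝ (Fin (k + 1)) × EuclideanSpace ℝ (Fin m)))).toLinearMap with hg
  have hfg : f.comp g = LinearMap.id := by
    ext x <;> simp [f, g, twistLin, T.a_b]
  have hgf : g.comp f = LinearMap.id := by
    ext x <;> simp [f, g, twistLin, T.b_a]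
  exact (LinearEquiv.ofLinear f g hfg hgf).isUnit_det'

/-- **On the core, the differential of the cone of the re-framed sphere is `dφ̂ ∘ twistLin`**:
`dφ̂'_{(u,0)} = dφ̂_{(u,0)} ∘ ((x₁, x₂) ↦ (x₁, a(u) x₂))` (Kervaire–Milnor 1963, proof of Lemma 6.1:
"`φ'_α(e^{q+1}) = φ'(e^{q+1}) · α(u)` at `(u, 0)`"). Both sides kill the normal `(u, 0)`, and on
the hyperplane `u^⊥ × ℝᵐ = range d(incl × id)` they are `dφ' = dφ ∘ d(twist diffeo)`.
[cite: KervaireMilnorAnnals1963, Lemma 6.1 (p. 521)] -/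
theorem coneDeriv_twist_zero (u : Metric.sphere (0 : EuclideanSpace ℝ (Fin (k + 1))) 1) :
    (ν.twist fun _ => T).coneDeriv i u 0 = (ν.coneDeriv i u 0).comp (twistLin T u) := by
  set ν' := ν.twist fun _ => T with hν'
  -- ### the chain rule `dφ'_{(u,0)} = dφ_{(u,0)} ∘ d(diffeo)_{(u,0)}`
  have hpt : T.diffeo (u, 0) = (u, 0) := Prod.ext rfl (by simp [TwistData.diffeo_apply])
  have hTd : MDifferentiableAt ((𝓡 k).prod 𝓘(ℝ, EuclideanSpace ℝ (Fin m)))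
      ((𝓡 k).prod 𝓘(ℝ, EuclideanSpace ℝ (Fin m))) T.diffeo (u, 0) :=
    (T.diffeo.contMDiff (u, 0)).mdifferentiableAt (by simp)
  have hνd : MDifferentiableAt ((𝓡 k).prod 𝓘(ℝ, EuclideanSpace ℝ (Fin m))) IX (ν.toFun i)
      (T.diffeo (u, 0)) :=
    (ν.contMDiff i _).mdifferentiableAt (by simp)
  have hchain := mfderiv_comp (u, (0 : EuclideanSpace ℝ (Fin m))) hνd hTd
  have hfun : ν.toFun i ∘ T.diffeo = ν'.toFun i := rfl
  rw [hfun] at hchain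
  rw [hpt] at hνd
  have hchain' : mfderiv ((𝓡 k).prod 𝓘(ℝ, EuclideanSpace ℝ (Fin m))) IX (ν'.toFun i) (u, 0) =
      (mfderiv ((𝓡 k).prod 𝓘(ℝ, EuclideanSpace ℝ (Fin m))) IX (ν.toFun i) (u, 0)).comp
        (mfderiv ((𝓡 k).prod 𝓘(ℝ, EuclideanSpace ℝ (Fin m)))
          ((𝓡 k).prod 𝓘(ℝ, EuclideanSpace ℝ (Fin m))) T.diffeo (u, 0)) := by
    rw [hchain]
    congr 1
    rw [hpt]
  -- ### equality on the hyperplane `u^⊥ × ℝᵐ` and on the normal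
  apply ContinuousLinearMap.ext
  intro x
  -- decompose `x = y + c • (u, 0)` with `y.1 ⊥ u`
  set c : ℝ := ⟪(u : EuclideanSpace ℝ (Fin (k + 1))), x.1⟫ with hc
  set y : EuclideanSpace ℝ (Fin (k + 1)) × EuclideanSpace ℝ (Fin m) :=
    (x.1 - c • (u : EuclideanSpace ℝ (Fin (k + 1))), x.2) with hy
  have hx : x = y + c • ((u : EuclideanSpace ℝ (Fin (k + 1))), (0 : EuclideanSpace ℝ (Fin m))) := by
    refine Prod.ext ?_ ?_
    · simp [hy]
    · simp [hy]
  have hy1 : ⟪(u : EuclideanSpace ℝ (Fin (k + 1))), y.1⟫ = 0 := by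
    have hu : ⟪(u : EuclideanSpace ℝ (Fin (k + 1))), (u : EuclideanSpace ℝ (Fin (k + 1)))⟫ = 1 := by
      rw [real_inner_self_eq_norm_sq, norm_eq_of_mem_sphere, one_pow]
    simp only [hy, inner_sub_right, inner_smul_right, hu, mul_one]
    ring
  -- the normal direction
  have hn' : ν'.coneDeriv i u 0 ((u : EuclideanSpace ℝ (Fin (k + 1))), 0) = 0 :=
    ν'.coneDeriv_apply_normal i u 0
  have hn : (ν.coneDeriv i u 0).comp (twistLin T u) ((u : EuclideanSpace ℝ (Fin (k + 1))), 0) = 0 := by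
    change ν.coneDeriv i u 0 (twistLin T u ((u : EuclideanSpace ℝ (Fin (k + 1))), 0)) = 0
    rw [twistLin_apply]
    simp only [map_zero]
    exact ν.coneDeriv_apply_normal i u 0
  -- the hyperplane: `y.1 = d(incl)_u ξ`
  obtain ⟨ξ, hξ⟩ : ∃ ξ : TangentSpace (𝓡 k) u, mfderiv (𝓡 k) 𝓘(ℝ, EuclideanSpace ℝ (Fin (k + 1)))
      (Subtype.val : Metric.sphere (0 : EuclideanSpace ℝ (Fin (k + 1))) 1 → _) u ξ = y.1 := by
    have hmem : y.1 ∈ (ℝ ∙ (u : EuclideanSpace ℝ (Fin (k + 1))))ᗮ :=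
      Submodule.mem_orthogonal_singleton_iff_inner_right.2 hy1
    rw [← range_mfderiv_coe_sphere (n := k) u] at hmem
    exact hmem
  -- `LHS y = dφ' (ξ, y.2)`
  have e1 : ν'.coneDeriv i u 0 y = mfderiv ((𝓡 k).prod 𝓘(ℝ, EuclideanSpace ℝ (Fin m))) IX (ν'.toFun i)
      (u, 0) (ξ, y.2) := by
    have h1 := DFunLike.congr_fun (ν'.coneDeriv_comp_eq i u 0)
      ((ξ, y.2) : EuclideanSpace ℝ (Fin k) × EuclideanSpace ℝ (Fin m))
    have h2 : mfderiv ((𝓡 k).prod 𝓘(ℝ, EuclideanSpace ℝ (Fin m)))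
        ((𝓘(ℝ, EuclideanSpace ℝ (Fin (k + 1)))).prod 𝓘(ℝ, EuclideanSpace ℝ (Fin m))) hyp
          (u, (0 : EuclideanSpace ℝ (Fin m))) (ξ, y.2) = y := by
      rw [mfderiv_hyp_apply]; exact Prod.ext hξ rfl
    exact ((congrArg (ν'.coneDeriv i u 0) h2).symm.trans h1)
  -- `RHS y = dφ (ξ, a(u) y.2)`
  have e2 : (ν.coneDeriv i u 0).comp (twistLin T u) y =
      mfderiv ((𝓡 k).prod 𝓘(ℝ, EuclideanSpace ℝ (Fin m))) IX (ν.toFun i) (u, 0) (ξ, T.a u y.2) := by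
    have h1 := DFunLike.congr_fun (ν.coneDeriv_comp_eq i u 0)
      ((ξ, T.a u y.2) : EuclideanSpace ℝ (Fin k) × EuclideanSpace ℝ (Fin m))
    have h2 : mfderiv ((𝓡 k).prod 𝓘(ℝ, EuclideanSpace ℝ (Fin m)))
        ((𝓘(ℝ, EuclideanSpace ℝ (Fin (k + 1)))).prod 𝓘(ℝ, EuclideanSpace ℝ (Fin m))) hyp
          (u, (0 : EuclideanSpace ℝ (Fin m))) (ξ, T.a u y.2) = twistLin T u y := by
      rw [mfderiv_hyp_apply, twistLin_apply]; exact Prod.ext hξ rfl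
    exact ((congrArg (ν.coneDeriv i u 0) h2).symm.trans h1)
  -- `dφ' (ξ, y.2) = dφ (d diffeo (ξ, y.2)) = dφ (ξ, a(u) y.2)`
  have e3 : mfderiv ((𝓡 k).prod 𝓘(ℝ, EuclideanSpace ℝ (Fin m))) IX (ν'.toFun i) (u, 0) (ξ, y.2) =
      mfderiv ((𝓡 k).prod 𝓘(ℝ, EuclideanSpace ℝ (Fin m))) IX (ν.toFun i) (u, 0) (ξ, T.a u y.2) := by
    have h1 := DFunLike.congr_fun hchain' ((ξ, y.2) : EuclideanSpace ℝ (Fin k) × EuclideanSpace ℝ (Fin m))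
    have h2 := mfderiv_diffeo_zero_apply T u ξ y.2
    exact h1.trans (congrArg _ h2)
  -- conclude by linearity
  rw [hx, map_add, map_add, map_smul, map_smul, hn', hn, e1, e3, ← e2]

end Twist

/-! ### Twisting the tube cylinder frame and the transition matrix -/

section TwistTrans

variable {n k l : ℕ} {X : Type u} [TopologicalSpace X] [ChartedSpace (EuclideanHalfSpace (n + 1)) X]
  [IsManifold (𝓡∂ (n + 1)) ∞ X] {ι : Type u}
  (ν : FramedSphereFamily (𝓡∂ (n + 1)) X ι k (l + 1)) (i : ι) (h : k + 1 + (l + 1) = n + 1 + 1)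
  (S : SFrame n X) (T : TwistData k (l + 1))

/-- The matrix of the twisting linear map in the basis `jbasis h` (the block matrix `1 ⊕ a(u)`).
[cite: KervaireMilnorAnnals1963, Lemma 6.1 (p. 521)] -/
def twistMat (u : Metric.sphere (0 : EuclideanSpace ℝ (Fin (k + 1))) 1) :
    Matrix (Fin (n + 1 + 1)) (Fin (n + 1 + 1)) ℝ :=
  LinearMap.toMatrix (jbasis h) (jbasis h) (twistLin T u).toLinearMap

/-- `det (twistMat) ≠ 0`. [folklore] -/
theorem det_twistMat_ne_zero (u : Metric.sphere (0 : EuclideanSpace ℝ (Fin (k + 1))) 1) :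
    (twistMat h T u).det ≠ 0 := by
  rw [twistMat, LinearMap.det_toMatrix]
  exact (isUnit_det_twistLin T u).ne_zero

/-- **Re-framing acts on the tube cylinder frame of the core by the block matrix `1 ⊕ a(u)`.**
[cite: KervaireMilnorAnnals1963, Lemma 6.1 (p. 521)] -/
theorem tubeCyl_twist_zero (u : Metric.sphere (0 : EuclideanSpace ℝ (Fin (k + 1))) 1) :
    (ν.twist fun _ => T).tubeCyl i h (u, 0) = act (ν.tubeCyl i h (u, 0)) (twistMat h T u) := by
  rw [tubeCyl, tubeCyl, twistMat, coneDeriv_twist_zero]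
  change cylT (hyp (u, (0 : EuclideanSpace ℝ (Fin (l + 1))))) h
      ((ν.coneDeriv i u 0).toLinearMap.comp (twistLin T u).toLinearMap) =
    act (cylT (hyp (u, (0 : EuclideanSpace ℝ (Fin (l + 1))))) h (ν.coneDeriv i u 0).toLinearMap)
      (LinearMap.toMatrix (jbasis h) (jbasis h) (twistLin T u).toLinearMap)
  refine cylT_comp (hyp (u, (0 : EuclideanSpace ℝ (Fin (l + 1))))) h _ _ (fun x => ?_) (fun x => ?_)
  · rw [PT_apply, PT_apply]
    rfl
  · rfl

/-- **Re-framing multiplies the transition matrix of the core by `(1 ⊕ a(u))⁻¹`**: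
`tubeTrans' (u, 0) = [1 ⊕ a(u)]⁻¹ · tubeTrans (u, 0)` (Kervaire–Milnor 1963, Lemma 6.1:
"`⟨fⁿ⁺¹, i'_α(tⁿ⁺¹)⟩ = ⟨fⁿ⁺¹, i'(tⁿ⁺¹)⟩ · s(α)`", here with the comparison written from the
frame side). [cite: KervaireMilnorAnnals1963, Lemma 6.1 (p. 521)] -/
theorem tubeTrans_twist_zero (u : Metric.sphere (0 : EuclideanSpace ℝ (Fin (k + 1))) 1) :
    (ν.twist fun _ => T).tubeTrans i h S (u, 0) = (twistMat h T u)⁻¹ * ν.tubeTrans i h S (u, 0) := by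
  have hpt : (ν.twist fun _ => T).toFun i (u, 0) = ν.toFun i (u, 0) := by
    rw [twist_toFun]; simp
  rw [tubeTrans, tubeTrans, hpt, tubeCyl_twist_zero]
  exact compMat_act_right (ν.linearIndependent_tubeCyl i h _) (det_twistMat_ne_zero h T u)

end TwistTrans



end FramedSphereFamily

end Literature.Topology.FourManifolds

end
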